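import Summits.ValiantsHypothesis.ValiantsHypothesis.Theorems.LacunarySymmetroidMatrixDescartesPivotStaircaseAllKCalculus

/-!
# `MatrixDescartes` (stmt-ValiantsHypothesis-18050) — POLE WEAVING, the two end slacks:
# `(1 − x + ε Σᵢ x^{nᵢ})·(1/32 + Σᵢ 8nᵢ x^{nᵢ}) − x²` alternates along `2c + 3` points of `(1/16, R]`

HONEST FRAMING.  Cell `pub-symmetroid`, seat `val-sym-mdr-p2` (gen 24); helper file `--supports` the crux
`Theses.LacunarySymmetroid.MatrixDescartes` (OPEN), NO closure claim.  Second real-analysis half of `…PivotStaircaseAllK`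
(«`Z₊ ≥ 2K` at `(2, K)`, index one, for EVERY `K`»; `RankOneStaircase`).  On top of the slack-free calculus of
`…PivotStaircaseAllKCalculus` (`g = (1 − x)·C − x²` alternates `−,+,…,+,−` along `2c + 1` interior points), the two slacks —
`1/32` in the bottom letter and `ε = 1/(512 (c+1)² T)` (`T = M^c` the top exponent) in the corner of every top letter — move NO
interior sign (`gs_peak_pos`, `gs_valley_neg`: they add `≤ 1/32 + 1/32` to a quantity `< 1/8 < 1/4 ≤ x²`, `slack_small`) and buy
the two END signs `gs(1/16) > 0` (`gs_left_pos`) and `gs(R) > 0` at `R = 2/ε = 1024 (c+1)² T` (`gs_right_pos`), so `gs` alternates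
`+,−,+,…,−,+` along the `2c + 3` points `1/16 < 1/2 < 1 − 1/(2n₀) < ⋯ < 1 − 1/(S n_{c−1}) < R` (`τ_succ_lt`, `τ_pos`, `gs_alternates`).
Nothing here bears on `MatrixDescartes` in its window, the upper pivot rungs, `DoorA26`/`DoorA34`, the registers, `VP ≠ VNP`.
[folklore] Elementary estimates only.
-/

set_option linter.dupNamespace false

namespace Summit.ValiantsHypothesis.ValiantsHypothesis.Theorems.LacunarySymmetroidMatrixDescartes.Pivot.PoleWeave

open scoped BigOperators
open Finset

/-! ### Notation (as in `…PivotStaircaseAllKCalculus`; local, no definitions) -/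

/-- The scale `S = 2^{c+7}`. -/
local notation3 (prettyPrint := false) "S⟦" c "⟧" => (2 ^ (c + 7))

/-- The exponents `nᵢ = (S²)^{i+1}`. -/
local notation3 (prettyPrint := false) "n⟦" c ", " i "⟧" => ((S⟦c⟧ * S⟦c⟧) ^ (i + 1))

/-- The top exponent `T = (S²)^c` (`= n_{c−1}` for `c ≥ 1`). -/
local notation3 (prettyPrint := false) "T⟦" c "⟧" => ((S⟦c⟧ * S⟦c⟧) ^ c)

/-- The slack-free closed form `g(t) = (1 − t)·Σᵢ 8nᵢ t^{nᵢ} − t²`. -/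
local notation3 (prettyPrint := false) "g⟦" c "⟧(" t ")" =>
  ((1 - t) * (∑ i : Fin c, (8 * (n⟦c, (i : ℕ)⟧ : ℝ)) * t ^ (n⟦c, (i : ℕ)⟧)) - t ^ 2)

/-- The gaps `ω_j` of the interior weaving points (`ω₀ = 1/2`, `ω_{2i+1} = 1/(2nᵢ)`, `ω_{2i+2} = 1/(S nᵢ)`). -/
local notation3 (prettyPrint := false) "ω⟦" c ", " j "⟧" =>
  (if j = 0 then ((1 : ℝ) / 2)
    else if j % 2 = 1 then (1 : ℝ) / (2 * (n⟦c, j / 2⟧ : ℝ))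
    else (1 : ℝ) / ((S⟦c⟧ * n⟦c, j / 2 - 1⟧ : ℕ) : ℝ))

/-- The corner slack `ε = 1/(512 (c+1)² T)`. -/
local notation3 (prettyPrint := false) "ε⟦" c "⟧" => ((1 : ℝ) / (512 * ((c : ℝ) + 1) ^ 2 * (T⟦c⟧ : ℝ)))

/-- The right end point `R = 1024 (c+1)² T = 2/ε`. -/
local notation3 (prettyPrint := false) "R⟦" c "⟧" => ((1024 : ℝ) * ((c : ℝ) + 1) ^ 2 * (T⟦c⟧ : ℝ))

/-- The closed form WITH slacks: `gs(t) = (1 − t + ε Σᵢ t^{nᵢ})·(1/32 + Σᵢ 8nᵢ t^{nᵢ}) − t²`. -/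
local notation3 (prettyPrint := false) "gs⟦" c "⟧(" t ")" =>
  ((1 - t + ε⟦c⟧ * ∑ i : Fin c, t ^ (n⟦c, (i : ℕ)⟧)) *
      ((1 : ℝ) / 32 + ∑ i : Fin c, (8 * (n⟦c, (i : ℕ)⟧ : ℝ)) * t ^ (n⟦c, (i : ℕ)⟧)) - t ^ 2)

/-! ### 1. The slacks move no interior sign and buy the two end signs -/

/-- `T ≥ 1`, and `nᵢ ≤ T` for `i < c`. -/
theorem top_facts (c : ℕ) : 1 ≤ (T⟦c⟧ : ℕ) ∧ ∀ i : ℕ, i < c → (n⟦c, i⟧ : ℕ) ≤ T⟦c⟧ := by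
  have hS1 := one_le_S c
  exact ⟨Nat.one_le_pow _ _ (Nat.mul_pos hS1 hS1),
    fun i hi => Nat.pow_le_pow_right (Nat.mul_pos hS1 hS1) (by omega)⟩

/-- On `[0, 1]`: the slack term `ε Σᵢ x^{nᵢ}` is at most `1/4`, and `ε · Σᵢ x^{nᵢ} · (1/32 + Σᵢ 8nᵢ x^{nᵢ}) ≤ 1/32`. -/
theorem slack_small (c : ℕ) (x : ℝ) (hx0 : 0 ≤ x) (hx1 : x ≤ 1) :
    ε⟦c⟧ * (∑ i : Fin c, x ^ (n⟦c, (i : ℕ)⟧)) ≤ 1 / 4 ∧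
    ε⟦c⟧ * (∑ i : Fin c, x ^ (n⟦c, (i : ℕ)⟧)) *
        ((1 : ℝ) / 32 + ∑ i : Fin c, (8 * (n⟦c, (i : ℕ)⟧ : ℝ)) * x ^ (n⟦c, (i : ℕ)⟧)) ≤ 1 / 32 := by
  obtain ⟨hT1, hn⟩ := top_facts c
  have hTR : (1 : ℝ) ≤ (T⟦c⟧ : ℝ) := by exact_mod_cast hT1
  have hc0 : (0 : ℝ) ≤ c := Nat.cast_nonneg c
  -- `Σ x^{nᵢ} ≤ c` and `Σ 8nᵢ x^{nᵢ} ≤ 8 c T`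
  have hE : (∑ i : Fin c, x ^ (n⟦c, (i : ℕ)⟧)) ≤ c := by
    have := Finset.sum_le_card_nsmul (Finset.univ : Finset (Fin c)) (fun i : Fin c => x ^ (n⟦c, (i : ℕ)⟧)) 1
      (fun i _ => pow_le_one₀ hx0 hx1)
    simpa using this
  have hE0 : 0 ≤ ∑ i : Fin c, x ^ (n⟦c, (i : ℕ)⟧) := Finset.sum_nonneg fun i _ => pow_nonneg hx0 _
  have hC : (∑ i : Fin c, (8 * (n⟦c, (i : ℕ)⟧ : ℝ)) * x ^ (n⟦c, (i : ℕ)⟧)) ≤ c * (8 * (T⟦c⟧ : ℝ)) := by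
    have := Finset.sum_le_card_nsmul (Finset.univ : Finset (Fin c))
      (fun i : Fin c => (8 * (n⟦c, (i : ℕ)⟧ : ℝ)) * x ^ (n⟦c, (i : ℕ)⟧)) (8 * (T⟦c⟧ : ℝ)) (fun i _ => by
        have hni : (n⟦c, (i : ℕ)⟧ : ℝ) ≤ (T⟦c⟧ : ℝ) := by exact_mod_cast hn i i.isLt
        have hxn : x ^ (n⟦c, (i : ℕ)⟧) ≤ 1 := pow_le_one₀ hx0 hx1
        calc (8 * (n⟦c, (i : ℕ)⟧ : ℝ)) * x ^ (n⟦c, (i : ℕ)⟧) ≤ (8 * (T⟦c⟧ : ℝ)) * 1 :=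
              mul_le_mul (by linarith) hxn (pow_nonneg hx0 _) (by positivity)
          _ = 8 * (T⟦c⟧ : ℝ) := mul_one _)
    simpa using this
  have hC0 : 0 ≤ ∑ i : Fin c, (8 * (n⟦c, (i : ℕ)⟧ : ℝ)) * x ^ (n⟦c, (i : ℕ)⟧) :=
    Finset.sum_nonneg fun i _ => by positivity
  have hε0 : 0 ≤ ε⟦c⟧ := by positivity
  have hden : (0 : ℝ) < 512 * ((c : ℝ) + 1) ^ 2 * (T⟦c⟧ : ℝ) := by positivity
  have hεE : ε⟦c⟧ * (∑ i : Fin c, x ^ (n⟦c, (i : ℕ)⟧)) ≤ ε⟦c⟧ * c := mul_le_mul_of_nonneg_left hE hε0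
  -- `ε c = c / (512 (c+1)² T) ≤ 1/512`
  have hεc : ε⟦c⟧ * c ≤ 1 / 512 := by
    rw [div_mul_eq_mul_div, one_mul, div_le_div_iff₀ hden (by norm_num)]
    nlinarith [mul_le_mul hTR hTR (by norm_num) (by linarith)]
  constructor
  · linarith
  · -- `ε c (1/32 + 8cT) ≤ c (1/32 + 8 c T) / (512 (c+1)² T) ≤ 9 (c+1)² T / (512 (c+1)² T) < 1/32`
    calc ε⟦c⟧ * (∑ i : Fin c, x ^ (n⟦c, (i : ℕ)⟧)) *
          ((1 : ℝ) / 32 + ∑ i : Fin c, (8 * (n⟦c, (i : ℕ)⟧ : ℝ)) * x ^ (n⟦c, (i : ℕ)⟧))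
        ≤ (ε⟦c⟧ * c) * (1 / 32 + c * (8 * (T⟦c⟧ : ℝ))) :=
          mul_le_mul hεE (by linarith) (by positivity) (by positivity)
      _ ≤ 1 / 32 := by
          rw [div_mul_eq_mul_div, one_mul, div_mul_eq_mul_div, div_le_div_iff₀ hden (by norm_num)]
          nlinarith [mul_nonneg hc0 (by positivity : (0 : ℝ) ≤ (T⟦c⟧ : ℝ)),
            mul_nonneg (mul_nonneg hc0 hc0) (by positivity : (0 : ℝ) ≤ (T⟦c⟧ : ℝ))]

/-- **Interior peaks keep their sign**: `gs ≥ g > 0` at `1 − 1/(2nᵢ)`. -/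
theorem gs_peak_pos (c i : ℕ) (hi : i < c) : 0 < gs⟦c⟧(1 - ω⟦c, 2 * i + 1⟧) := by
  have hg := g_odd_pos c i hi
  rw [ω_odd] at hg ⊢
  set x : ℝ := 1 - 1 / (2 * (n⟦c, i⟧ : ℝ)) with hx
  have hn : (1 : ℝ) ≤ (n⟦c, i⟧ : ℝ) := by exact_mod_cast one_le_n c i
  have hx1 : x ≤ 1 := by
    have : 0 < 1 / (2 * (n⟦c, i⟧ : ℝ)) := by positivity
    rw [hx]; linarith
  have hx0 : 0 ≤ x := by
    rw [hx, sub_nonneg, div_le_one (by positivity)]; linarith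
  have hE0 : 0 ≤ ε⟦c⟧ * ∑ j : Fin c, x ^ (n⟦c, (j : ℕ)⟧) :=
    mul_nonneg (by positivity) (Finset.sum_nonneg fun j _ => pow_nonneg hx0 _)
  have hC0 : 0 ≤ ∑ j : Fin c, (8 * (n⟦c, (j : ℕ)⟧ : ℝ)) * x ^ (n⟦c, (j : ℕ)⟧) :=
    Finset.sum_nonneg fun j _ => by positivity
  -- `(1 − x + εE)(1/32 + C) ≥ (1 − x) C`
  have hmono : (1 - x) * (∑ j : Fin c, (8 * (n⟦c, (j : ℕ)⟧ : ℝ)) * x ^ (n⟦c, (j : ℕ)⟧))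
      ≤ (1 - x + ε⟦c⟧ * ∑ j : Fin c, x ^ (n⟦c, (j : ℕ)⟧)) *
          ((1 : ℝ) / 32 + ∑ j : Fin c, (8 * (n⟦c, (j : ℕ)⟧ : ℝ)) * x ^ (n⟦c, (j : ℕ)⟧)) :=
    mul_le_mul (by linarith) (by linarith) hC0 (by linarith)
  linarith

/-- **Interior valleys keep their sign**: at `1/2` and at `1 − 1/(S nᵢ)` the slacks add `≤ 1/32 + 1/32` to a quantity
`< 1/8`, still below `x² ≥ 1/4`. -/
theorem gs_valley_neg (c i : ℕ) : gs⟦c⟧(1 - ω⟦c, 2 * i⟧) < 0 := by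
  have hfrac := frac_lt_eighth c
  rcases i with _ | i
  · rw [show (2 * 0 : ℕ) = 0 from rfl, ω_zero, show (1 : ℝ) - 1 / 2 = 1 / 2 by norm_num]
    have hb := bumps_half_le c
    obtain ⟨hs1, -⟩ := slack_small c ((1 : ℝ) / 2) (by norm_num) (by norm_num)
    have hC0 : 0 ≤ ∑ j : Fin c, (8 * (n⟦c, (j : ℕ)⟧ : ℝ)) * ((1 : ℝ) / 2) ^ (n⟦c, (j : ℕ)⟧) :=
      Finset.sum_nonneg fun j _ => by positivity
    -- first factor `≤ 3/4`, second `≤ 1/32 + 1/4`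
    have hC : (∑ j : Fin c, (8 * (n⟦c, (j : ℕ)⟧ : ℝ)) * ((1 : ℝ) / 2) ^ (n⟦c, (j : ℕ)⟧)) < 1 / 4 := by linarith
    have h1 : (1 - (1 : ℝ) / 2 + ε⟦c⟧ * ∑ j : Fin c, ((1 : ℝ) / 2) ^ (n⟦c, (j : ℕ)⟧)) ≤ 3 / 4 := by linarith
    have hprod : (1 - (1 : ℝ) / 2 + ε⟦c⟧ * ∑ j : Fin c, ((1 : ℝ) / 2) ^ (n⟦c, (j : ℕ)⟧)) *
        ((1 : ℝ) / 32 + ∑ j : Fin c, (8 * (n⟦c, (j : ℕ)⟧ : ℝ)) * ((1 : ℝ) / 2) ^ (n⟦c, (j : ℕ)⟧))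
          ≤ (3 / 4) * ((1 : ℝ) / 32 + 1 / 4) :=
      mul_le_mul h1 (by linarith) (by positivity) (by norm_num)
    have h14 : ((1 : ℝ) / 2) ^ 2 = 1 / 4 := by norm_num
    rw [h14]
    linarith
  · rw [show 2 * (i + 1) = 2 * i + 2 by ring, ω_even]
    have hb := bumps_valley_le c i
    obtain ⟨hx0', hx1⟩ := half_le_valley c i
    set x : ℝ := 1 - 1 / ((S⟦c⟧ * n⟦c, i⟧ : ℕ) : ℝ) with hx
    have hx0 : 0 ≤ x := by linarith
    obtain ⟨-, hs2⟩ := slack_small c x hx0 hx1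
    have hC0 : 0 ≤ ∑ j : Fin c, (8 * (n⟦c, (j : ℕ)⟧ : ℝ)) * x ^ (n⟦c, (j : ℕ)⟧) :=
      Finset.sum_nonneg fun j _ => by positivity
    have hsq : (1 : ℝ) / 4 ≤ x ^ 2 := by nlinarith
    -- expand: `(1 − x)(1/32) + (1 − x) C + εE (1/32 + C) − x²`
    have hexp : gs⟦c⟧(x) = (1 - x) * (1 / 32)
        + (1 - x) * (∑ j : Fin c, (8 * (n⟦c, (j : ℕ)⟧ : ℝ)) * x ^ (n⟦c, (j : ℕ)⟧))
        + ε⟦c⟧ * (∑ j : Fin c, x ^ (n⟦c, (j : ℕ)⟧)) *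
            ((1 : ℝ) / 32 + ∑ j : Fin c, (8 * (n⟦c, (j : ℕ)⟧ : ℝ)) * x ^ (n⟦c, (j : ℕ)⟧)) - x ^ 2 := by
      ring
    rw [hexp]
    have h32 : (1 - x) * ((1 : ℝ) / 32) ≤ 1 / 32 := by nlinarith
    linarith

/-- **The left end**: `gs(1/16) > 0` (the slack `1/32` of the bottom letter: `(15/16)·(1/32) > (1/16)²`). -/
theorem gs_left_pos (c : ℕ) : 0 < gs⟦c⟧((1 : ℝ) / 16) := by
  have hE0 : 0 ≤ ε⟦c⟧ * ∑ j : Fin c, ((1 : ℝ) / 16) ^ (n⟦c, (j : ℕ)⟧) :=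
    mul_nonneg (by positivity) (Finset.sum_nonneg fun j _ => by positivity)
  have hC0 : 0 ≤ ∑ j : Fin c, (8 * (n⟦c, (j : ℕ)⟧ : ℝ)) * ((1 : ℝ) / 16) ^ (n⟦c, (j : ℕ)⟧) :=
    Finset.sum_nonneg fun j _ => by positivity
  have hmono : (1 - (1 : ℝ) / 16) * ((1 : ℝ) / 32)
      ≤ (1 - (1 : ℝ) / 16 + ε⟦c⟧ * ∑ j : Fin c, ((1 : ℝ) / 16) ^ (n⟦c, (j : ℕ)⟧)) *
          ((1 : ℝ) / 32 + ∑ j : Fin c, (8 * (n⟦c, (j : ℕ)⟧ : ℝ)) * ((1 : ℝ) / 16) ^ (n⟦c, (j : ℕ)⟧)) :=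
    mul_le_mul (by linarith) (by linarith) (by norm_num) (by linarith)
  have h : ((1 : ℝ) / 16) ^ 2 = 1 / 256 := by norm_num
  rw [h]
  linarith

/-- **The right end**: `gs(R) > 0` at `R = 2/ε = 1024 (c+1)² T` (the corner slack: `1 − R + ε Σᵢ R^{nᵢ} ≥ 1 − R + ε R² = 1 + R`,
and `1/32 + Σᵢ 8nᵢ R^{nᵢ} ≥ 8 R²`). -/
theorem gs_right_pos (c : ℕ) (hc : 1 ≤ c) : 0 < gs⟦c⟧(R⟦c⟧) := by
  obtain ⟨hT1, -⟩ := top_facts c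
  have hTR : (1 : ℝ) ≤ (T⟦c⟧ : ℝ) := by exact_mod_cast hT1
  have hc1 : (1 : ℝ) ≤ (c : ℝ) + 1 := by have := Nat.cast_nonneg (α := ℝ) c; linarith
  have hc0 : (0 : ℝ) ≤ (c : ℝ) + 1 := by linarith
  set R : ℝ := R⟦c⟧ with hR
  have hR1 : (1 : ℝ) ≤ R := by
    rw [hR]
    nlinarith [mul_le_mul hc1 hc1 (by norm_num) hc0, mul_le_mul (mul_le_mul hc1 hc1 (by norm_num) hc0) hTR
      (by norm_num) (by positivity)]
  have hR0 : (0 : ℝ) ≤ R := by linarith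
  have hεR : ε⟦c⟧ * R = 2 := by
    rw [hR]; field_simp; norm_num
  -- powers of `R ≥ 1` dominate `R²` once the exponent is `≥ 2`
  have hpow : ∀ m : ℕ, 2 ≤ m → R ^ 2 ≤ R ^ m := fun m hm => pow_le_pow_right₀ hR1 hm
  have hS1 := one_le_S c
  have h2S : 2 ≤ (S⟦c⟧ : ℕ) := le_trans (by omega) (S_ge c)
  have h2T : 2 ≤ (T⟦c⟧ : ℕ) :=
    calc 2 ≤ S⟦c⟧ := h2S
      _ ≤ S⟦c⟧ * S⟦c⟧ := Nat.le_mul_of_pos_right _ hS1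
      _ = (S⟦c⟧ * S⟦c⟧) ^ 1 := (pow_one _).symm
      _ ≤ (S⟦c⟧ * S⟦c⟧) ^ c := Nat.pow_le_pow_right (Nat.mul_pos hS1 hS1) hc
  have h2n0 : 2 ≤ (n⟦c, 0⟧ : ℕ) := le_trans h2S (S_le_n c 0)
  have htop : (n⟦c, c - 1⟧ : ℕ) = T⟦c⟧ := by rw [show c - 1 + 1 = c by omega]
  -- first factor `≥ 1 + R`: the top term `ε R^{T}` alone gives `ε R² = 2R`
  have hE : R ^ (T⟦c⟧) ≤ ∑ j : Fin c, R ^ (n⟦c, (j : ℕ)⟧) := by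
    have := Finset.single_le_sum (s := (Finset.univ : Finset (Fin c)))
      (f := fun j : Fin c => R ^ (n⟦c, (j : ℕ)⟧)) (fun j _ => by positivity) (Finset.mem_univ ⟨c - 1, by omega⟩)
    rw [← htop]
    simpa using this
  have hfac1 : 1 + R ≤ 1 - R + ε⟦c⟧ * ∑ j : Fin c, R ^ (n⟦c, (j : ℕ)⟧) := by
    have h1 : ε⟦c⟧ * R ^ 2 ≤ ε⟦c⟧ * ∑ j : Fin c, R ^ (n⟦c, (j : ℕ)⟧) :=
      mul_le_mul_of_nonneg_left ((hpow _ h2T).trans hE) (by positivity)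
    have h2 : ε⟦c⟧ * R ^ 2 = 2 * R := by
      rw [show R ^ 2 = R * R from pow_two R, ← mul_assoc, hεR]
    linarith
  -- second factor `≥ 8 R²`: the bottom term `8 n₀ R^{n₀}`
  have hfac2 : 8 * R ^ 2 ≤ (1 : ℝ) / 32 + ∑ j : Fin c, (8 * (n⟦c, (j : ℕ)⟧ : ℝ)) * R ^ (n⟦c, (j : ℕ)⟧) := by
    have hsum : (8 * (n⟦c, 0⟧ : ℝ)) * R ^ (n⟦c, 0⟧)
        ≤ ∑ j : Fin c, (8 * (n⟦c, (j : ℕ)⟧ : ℝ)) * R ^ (n⟦c, (j : ℕ)⟧) := by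
      have := Finset.single_le_sum (s := (Finset.univ : Finset (Fin c)))
        (f := fun j : Fin c => (8 * (n⟦c, (j : ℕ)⟧ : ℝ)) * R ^ (n⟦c, (j : ℕ)⟧))
        (fun j _ => by positivity) (Finset.mem_univ ⟨0, by omega⟩)
      simpa using this
    have hn : (1 : ℝ) ≤ (n⟦c, 0⟧ : ℝ) := by exact_mod_cast one_le_n c 0
    have hp : R ^ 2 ≤ R ^ (n⟦c, 0⟧) := hpow _ h2n0
    have h8 : 8 * R ^ 2 ≤ (8 * (n⟦c, 0⟧ : ℝ)) * R ^ (n⟦c, 0⟧) := by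
      calc 8 * R ^ 2 = (8 * 1) * R ^ 2 := by ring
        _ ≤ (8 * (n⟦c, 0⟧ : ℝ)) * R ^ (n⟦c, 0⟧) :=
          mul_le_mul (by linarith) hp (by positivity) (by positivity)
    linarith
  have hprod := mul_le_mul hfac1 hfac2 (by positivity) (by linarith)
  have h8 : R ^ 2 < (1 + R) * (8 * R ^ 2) := by nlinarith
  exact sub_pos.2 (h8.trans_le hprod)

/-! ### 2. The `2c + 3` weaving points `1/16 < 1/2 < 1 − 1/(2n₀) < ⋯ < 1 − 1/(S n_{c−1}) < R` -/

/-- The weaving points (local notation): `τ₀ = 1/16`, `τ_{j+1} = 1 − ω_j` (`j ≤ 2c`), `τ_{2c+2} = R`. -/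
local notation3 (prettyPrint := false) "τ⟦" c ", " j "⟧" =>
  (if j = 0 then ((1 : ℝ) / 16) else if j = 2 * c + 2 then R⟦c⟧ else 1 - ω⟦c, j - 1⟧)

/-- `R > 1`. -/
theorem one_lt_R (c : ℕ) : (1 : ℝ) < R⟦c⟧ := by
  obtain ⟨hT1, -⟩ := top_facts c
  have hTR : (1 : ℝ) ≤ (T⟦c⟧ : ℝ) := by exact_mod_cast hT1
  have hc1 : (1 : ℝ) ≤ (c : ℝ) + 1 := by have := Nat.cast_nonneg (α := ℝ) c; linarith
  have hc0 : (0 : ℝ) ≤ (c : ℝ) + 1 := by linarith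
  nlinarith [mul_le_mul hc1 hc1 (by norm_num) hc0, mul_le_mul (mul_le_mul hc1 hc1 (by norm_num) hc0) hTR
    (by norm_num) (by positivity)]

/-- `τ₀ = 1/16`. -/
theorem τ_zero (c : ℕ) : τ⟦c, 0⟧ = (1 : ℝ) / 16 := by
  rw [if_pos (show (0 : ℕ) = 0 from rfl)]

/-- `τ_{2c+2} = R`. -/
theorem τ_last (c : ℕ) : τ⟦c, 2 * c + 2⟧ = R⟦c⟧ := by
  rw [if_neg (show ¬ (2 * c + 2 = 0) by omega), if_pos (show 2 * c + 2 = 2 * c + 2 from rfl)]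

/-- `τ_j = 1 − ω_{j−1}` for `1 ≤ j ≤ 2c + 1`. -/
theorem τ_mid (c j : ℕ) (h1 : 1 ≤ j) (h2 : j ≤ 2 * c + 1) : τ⟦c, j⟧ = 1 - ω⟦c, j - 1⟧ := by
  rw [if_neg (show ¬ (j = 0) by omega), if_neg (show ¬ (j = 2 * c + 2) by omega)]

/-- Consecutive weaving points increase. -/
theorem τ_succ_lt (c j : ℕ) (hj : j < 2 * c + 2) : τ⟦c, j⟧ < τ⟦c, j + 1⟧ := by
  rcases Nat.lt_or_ge j 1 with h0 | h1
  · -- `τ₀ = 1/16 < 1/2 = τ₁`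
    have hj0 : j = 0 := by omega
    subst hj0
    rw [τ_zero, τ_mid c (0 + 1) (by omega) (by omega), show 0 + 1 - 1 = 0 from rfl, ω_zero]
    norm_num
  · rcases Nat.lt_or_ge (j + 1) (2 * c + 2) with h2 | h2
    · -- interior: `1 − ω_{j−1} < 1 − ω_j`
      rw [τ_mid c j h1 (by omega), τ_mid c (j + 1) (by omega) (by omega), show j + 1 - 1 = (j - 1) + 1 by omega]
      have := ω_succ_lt c (j - 1) (by omega)
      linarith
    · -- `τ_{2c+1} = 1 − ω_{2c} < 1 < R = τ_{2c+2}`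
      have hj' : j + 1 = 2 * c + 2 := by omega
      rw [τ_mid c j h1 (by omega), hj', τ_last]
      have hR := one_lt_R c
      obtain ⟨i, hi | hi⟩ := Nat.even_or_odd' (j - 1)
      · rcases i with _ | i
        · rw [show j - 1 = 0 by omega, ω_zero]; linarith
        · rw [hi, show 2 * (i + 1) = 2 * i + 2 by ring, ω_even]
          have : (0 : ℝ) < 1 / ((S⟦c⟧ * n⟦c, i⟧ : ℕ) : ℝ) := by
            have : (0 : ℝ) < ((S⟦c⟧ * n⟦c, i⟧ : ℕ) : ℝ) := by
              exact_mod_cast Nat.mul_pos (one_le_S c) (one_le_n c i)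
            positivity
          linarith
      · rw [hi, ω_odd]
        have : (0 : ℝ) < 1 / (2 * (n⟦c, i⟧ : ℝ)) := by
          have : (0 : ℝ) < (n⟦c, i⟧ : ℝ) := by exact_mod_cast one_le_n c i
          positivity
        linarith

/-- The weaving points are positive. -/
theorem τ_pos (c j : ℕ) (hj : j ≤ 2 * c + 2) : 0 < τ⟦c, j⟧ := by
  rcases Nat.lt_or_ge j 1 with h0 | h1
  · rw [show j = 0 by omega, τ_zero]; norm_num
  · rcases Nat.lt_or_ge j (2 * c + 2) with h2 | h2
    · rw [τ_mid c j h1 (by omega)]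
      have := ω_lt_one c (j - 1)
      linarith
    · rw [show j = 2 * c + 2 by omega, τ_last]; linarith [one_lt_R c]

/-- Signs along the weaving points: `+` at even positions, `−` at odd positions. -/
theorem gs_sign (c j : ℕ) (hc : 1 ≤ c) (hj : j ≤ 2 * c + 2) :
    (j % 2 = 0 → 0 < gs⟦c⟧(τ⟦c, j⟧)) ∧ (j % 2 = 1 → gs⟦c⟧(τ⟦c, j⟧) < 0) := by
  rcases Nat.lt_or_ge j 1 with h0 | h1
  · rw [show j = 0 by omega, τ_zero]
    exact ⟨fun _ => gs_left_pos c, fun h => by omega⟩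
  · rcases Nat.lt_or_ge j (2 * c + 2) with h2 | h2
    · rw [τ_mid c j h1 (by omega)]
      obtain ⟨i, hi | hi⟩ := Nat.even_or_odd' (j - 1)
      · -- `j − 1 = 2i`: a valley, `j` odd
        refine ⟨fun h => by omega, fun _ => ?_⟩
        rw [hi]; exact gs_valley_neg c i
      · -- `j − 1 = 2i + 1`: a peak, `j` even
        refine ⟨fun _ => ?_, fun h => by omega⟩
        rw [hi]; exact gs_peak_pos c i (by omega)
    · rw [show j = 2 * c + 2 by omega, τ_last]
      exact ⟨fun _ => gs_right_pos c hc, fun h => by omega⟩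

/-- Consecutive weaving points carry opposite signs. -/
theorem gs_alternates (c j : ℕ) (hc : 1 ≤ c) (hj : j < 2 * c + 2) :
    gs⟦c⟧(τ⟦c, j⟧) * gs⟦c⟧(τ⟦c, j + 1⟧) < 0 := by
  obtain ⟨he, ho⟩ := gs_sign c j hc hj.le
  obtain ⟨he', ho'⟩ := gs_sign c (j + 1) hc (by omega)
  rcases Nat.mod_two_eq_zero_or_one j with h | h
  · exact mul_neg_of_pos_of_neg (he h) (ho' (by omega))
  · exact mul_neg_of_neg_of_pos (ho h) (he' (by omega))

end Summit.ValiantsHypothesis.ValiantsHypothesis.Theorems.LacunarySymmetroidMatrixDescartes.Pivot.PoleWeave
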